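/-
Copyright: the b2b-balaban T⁴-continuum CRUX team, row NE7b OWNER lineage `t4-ne7b-p1` (gen 142). Project licence.
-/
import Mathlib.Data.Real.Basic
import Mathlib.Tactic

/-!
# THE FOURTH-ORDER CUMULANT IDENTITY IN THE CENTRED (TILTED-PIECE) FORMAT (pure algebra; SCOPING (d13)(2): the cumulant FORM of `∂⁴W`, eighth
# file).  (517) regrouped (516)'s raw fourth derivative, split into the 51 canonical monomial letters `x_M = ∫e^{−U}M`, into the EXPANDED cumulant
# polynomial.  The piece files of the order-4 kernel letter ((500) average, (501)∕(502) two-point, (508)∕(509) three-point, (497) fourth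
# cumulant) are stated in the TILTED-PIECE format — covariances `Z⁻¹x_{XY} − Z⁻²x_Xx_Y`, centred triples `Z⁻¹∫e(B−b)(A−a)(A′−a′)` and the
# centred quadruple∕pairs of `κ₄` with centring constants `a = Z⁻¹x_A`, `b = Z⁻¹x_B` — so the display of the next file is
#   `∂⁴W[h,k,l,m] = ⟨D⟩ − Σ₄Cov(C,A) − Σ₃Cov(B,B′) + Σ₆Z⁻¹∫e(·−·)(·−·)(·−·) − [Z⁻¹∫eÂ_mÂ_hÂ_kÂ_l − Σ₃(Z⁻¹∫eÂÂ)(Z⁻¹∫eÂÂ)]`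
# with the `m`-carrying factor first in every product.  This file is the letters identity behind it: (516)'s raw polynomial (each composite
# integral replaced by its split, (519)) EQUALS that display with every centred integral replaced by ITS split — an identity of rational
# functions in `Z` and the 51 letters, `Z ≠ 0`, checked symbolically before typing and here by `field_simp; ring` (row NE7b, node U5c; Mathlib
# only; [folklore])

Cell `pub-balaban`, sub-cell `t4`, spine estimate NE7b (`T4WeightBudget.RelWeightBound`; the cell's OWN estimate — NOT PRINTED in
[Bałaban 1983–89], NOT PROVED).  Crux-route work under `Spine/NE7b/` by the row OWNER (`t4-ne7b-p1` gen 142, file (520)) under FREEZE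
(0)'s crux-prover clause; NOTHING of Bałaban's is named as a Lean object, valued or asserted; no `T4Continuum/Support` leaf typed; no
`def`, no notation; zero `sorry`.  Imports: Mathlib only.

WHAT IS PROVED ([folklore]): **`fourth_cumulant_identity_centred`** (the 52 reals implicit — they are read off the goal by unification in the next
file); §2 toy.

HONEST (what this is NOT).  Letters only; the substitution of the tilted integrals is the next file; the assembly of the order-4 kernel letter
after it.  Scalar skeleton ((A3), NC-NE7b-α UNRULED); nothing of Bałaban's asserted.  BY-NAME EFFECT ON THE WALL: NONE.  NE7b NOT PRINTED ∕ NOT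
PROVED; spine PROVED 0∕9; rung (B)+1 — the programme's measures remain FINITE-torus statements; NOT the mass gap, NOT Clay.  HONEST DEPENDENCY:
continuum YM on T⁴ ⇐ BetaPertH ∧ nine spine estimates (0∕9 proved); BetaPertH ⇐ (D1) ∧ (D4) ∧ CAP+tail; G-an2-4 gates asym, D1 and NE2∕3∕4.
-/

set_option autoImplicit false

namespace Summit.QuantumFields.BalabanUV.T4Continuum.NE7b.SupFourthCumulantIdentityCentred

/-! ## §1. The identity -/

/-- **THE FOURTH-ORDER CUMULANT IDENTITY, CENTRED FORMAT**: raw fourth derivative (composites split into canonical letters) = tilted-piece display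
(centred integrals split likewise), for `Z ≠ 0`. [folklore] -/
theorem fourth_cumulant_identity_centred {Z xAh xAh_Ak xAh_Ak_Al xAh_Al xAh_Bkl xAk xAk_Al xAk_Bhl xAl xAl_Bhk xAm xAm_Ah xAm_Ah_Ak xAm_Ah_Ak_Al
    xAm_Ah_Al xAm_Ah_Bkl xAm_Ak xAm_Ak_Al xAm_Ak_Bhl xAm_Al xAm_Al_Bhk xAm_Bhk xAm_Bhl xAm_Bkl xAm_Chkl xBhk xBhl xBkl xBmh xBmh_Ak xBmh_Ak_Al
    xBmh_Al xBmh_Bkl xBmk xBmk_Ah xBmk_Ah_Al xBmk_Al xBmk_Bhl xBml xBml_Ah xBml_Ah_Ak xBml_Ak xBml_Bhk xChkl xCmhk xCmhk_Al xCmhl xCmhl_Ak xCmkl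
    xCmkl_Ah xDmhkl : ℝ}
    (hZ : Z ≠ 0) :
    (Z)⁻¹ * (xDmhkl - xCmhl_Ak - xBmk_Bhl - xBml_Bhk - xCmhk_Al - xCmkl_Ah - xBmh_Bkl + xBml_Ah_Ak + xBmk_Ah_Al + xBmh_Ak_Al - xAm_Chkl + xAm_Ak_Bhl
        + xAm_Al_Bhk + xAm_Ah_Bkl - xAm_Ah_Ak_Al) - -xAm * (Z ^ 2)⁻¹ * (xChkl - xAk_Bhl - xAl_Bhk - xAh_Bkl + xAh_Ak_Al) +
        ((Z ^ 2)⁻¹ * ((xBmh - xAm_Ah) * (xBkl - xAk_Al) + xAh * (xCmkl - xBml_Ak - xBmk_Al - xAm_Bkl + xAm_Ak_Al)) - 2 * -xAm * (Z ^ 3)⁻¹ * (xAh *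
            (xBkl - xAk_Al))) +
        ((Z ^ 2)⁻¹ * ((xBmk - xAm_Ak) * (xBhl - xAh_Al) + xAk * (xCmhl - xBml_Ah - xBmh_Al - xAm_Bhl + xAm_Ah_Al)) - 2 * -xAm * (Z ^ 3)⁻¹ * (xAk *
            (xBhl - xAh_Al))) +
        ((Z ^ 2)⁻¹ * ((xCmhk - xBmk_Ah - xBmh_Ak - xAm_Bhk + xAm_Ah_Ak) * xAl + (xBhk - xAh_Ak) * (xBml - xAm_Al)) - 2 * -xAm * (Z ^ 3)⁻¹ * ((xBhk -
            xAh_Ak) * xAl)) +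
        (2 * (Z ^ 3)⁻¹ * ((xBmh - xAm_Ah) * xAk * xAl + xAh * (xBmk - xAm_Ak) * xAl + xAh * xAk * (xBml - xAm_Al)) -
          6 * -xAm * (Z ^ 4)⁻¹ * (xAh * xAk * xAl)) =
      Z⁻¹ * xDmhkl -
        ((Z⁻¹ * xCmkl_Ah - (Z ^ 2)⁻¹ * (xCmkl * xAh)) + (Z⁻¹ * xCmhl_Ak - (Z ^ 2)⁻¹ * (xCmhl * xAk)) + (Z⁻¹ * xCmhk_Al - (Z ^ 2)⁻¹ * (xCmhk * xAl)) +
            (Z⁻¹ * xAm_Chkl - (Z ^ 2)⁻¹ * (xAm * xChkl))) -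
        ((Z⁻¹ * xBmh_Bkl - (Z ^ 2)⁻¹ * (xBmh * xBkl)) + (Z⁻¹ * xBmk_Bhl - (Z ^ 2)⁻¹ * (xBmk * xBhl)) + (Z⁻¹ * xBml_Bhk - (Z ^ 2)⁻¹ * (xBml * xBhk))) +
        (Z⁻¹ * (xBmh_Ak_Al - (Z⁻¹ * xAl) * xBmh_Ak - (Z⁻¹ * xAk) * xBmh_Al + (Z⁻¹ * xAk) * (Z⁻¹ * xAl) * xBmh - (Z⁻¹ * xBmh) * xAk_Al + (Z⁻¹ * xAl) *
            (Z⁻¹ * xBmh) * xAk + (Z⁻¹ * xAk) * (Z⁻¹ * xBmh) * xAl - (Z⁻¹ * xAk) * (Z⁻¹ * xAl) * (Z⁻¹ * xBmh) * Z) + Z⁻¹ * (xBmk_Ah_Al - (Z⁻¹ * xAl) *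
            xBmk_Ah - (Z⁻¹ * xAh) * xBmk_Al + (Z⁻¹ * xAh) * (Z⁻¹ * xAl) * xBmk - (Z⁻¹ * xBmk) * xAh_Al + (Z⁻¹ * xAl) * (Z⁻¹ * xBmk) * xAh + (Z⁻¹ *
            xAh) * (Z⁻¹ * xBmk) * xAl - (Z⁻¹ * xAh) * (Z⁻¹ * xAl) * (Z⁻¹ * xBmk) * Z) + Z⁻¹ * (xBml_Ah_Ak - (Z⁻¹ * xAk) * xBml_Ah - (Z⁻¹ * xAh) *
            xBml_Ak + (Z⁻¹ * xAh) * (Z⁻¹ * xAk) * xBml - (Z⁻¹ * xBml) * xAh_Ak + (Z⁻¹ * xAk) * (Z⁻¹ * xBml) * xAh + (Z⁻¹ * xAh) * (Z⁻¹ * xBml) * xAk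
            - (Z⁻¹ * xAh) * (Z⁻¹ * xAk) * (Z⁻¹ * xBml) * Z) + Z⁻¹ * (xAm_Al_Bhk - (Z⁻¹ * xAl) * xAm_Bhk - (Z⁻¹ * xBhk) * xAm_Al + (Z⁻¹ * xAl) * (Z⁻¹
            * xBhk) * xAm - (Z⁻¹ * xAm) * xAl_Bhk + (Z⁻¹ * xAm) * (Z⁻¹ * xAl) * xBhk + (Z⁻¹ * xAm) * (Z⁻¹ * xBhk) * xAl - (Z⁻¹ * xAm) * (Z⁻¹ * xAl) *
            (Z⁻¹ * xBhk) * Z) + Z⁻¹ * (xAm_Ak_Bhl - (Z⁻¹ * xAk) * xAm_Bhl - (Z⁻¹ * xBhl) * xAm_Ak + (Z⁻¹ * xAk) * (Z⁻¹ * xBhl) * xAm - (Z⁻¹ * xAm) *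
            xAk_Bhl + (Z⁻¹ * xAm) * (Z⁻¹ * xAk) * xBhl + (Z⁻¹ * xAm) * (Z⁻¹ * xBhl) * xAk - (Z⁻¹ * xAm) * (Z⁻¹ * xAk) * (Z⁻¹ * xBhl) * Z) + Z⁻¹ *
            (xAm_Ah_Bkl - (Z⁻¹ * xAh) * xAm_Bkl - (Z⁻¹ * xBkl) * xAm_Ah + (Z⁻¹ * xAh) * (Z⁻¹ * xBkl) * xAm - (Z⁻¹ * xAm) * xAh_Bkl + (Z⁻¹ * xAm) *
            (Z⁻¹ * xAh) * xBkl + (Z⁻¹ * xAm) * (Z⁻¹ * xBkl) * xAh - (Z⁻¹ * xAm) * (Z⁻¹ * xAh) * (Z⁻¹ * xBkl) * Z)) -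
        (Z⁻¹ * (xAm_Ah_Ak_Al - (Z⁻¹ * xAl) * xAm_Ah_Ak - (Z⁻¹ * xAk) * xAm_Ah_Al + (Z⁻¹ * xAk) * (Z⁻¹ * xAl) * xAm_Ah - (Z⁻¹ * xAh) * xAm_Ak_Al +
            (Z⁻¹ * xAh) * (Z⁻¹ * xAl) * xAm_Ak + (Z⁻¹ * xAh) * (Z⁻¹ * xAk) * xAm_Al - (Z⁻¹ * xAh) * (Z⁻¹ * xAk) * (Z⁻¹ * xAl) * xAm - (Z⁻¹ * xAm) *
            xAh_Ak_Al + (Z⁻¹ * xAm) * (Z⁻¹ * xAl) * xAh_Ak + (Z⁻¹ * xAm) * (Z⁻¹ * xAk) * xAh_Al - (Z⁻¹ * xAm) * (Z⁻¹ * xAk) * (Z⁻¹ * xAl) * xAh +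
            (Z⁻¹ * xAm) * (Z⁻¹ * xAh) * xAk_Al - (Z⁻¹ * xAm) * (Z⁻¹ * xAh) * (Z⁻¹ * xAl) * xAk - (Z⁻¹ * xAm) * (Z⁻¹ * xAh) * (Z⁻¹ * xAk) * xAl + (Z⁻¹
            * xAm) * (Z⁻¹ * xAh) * (Z⁻¹ * xAk) * (Z⁻¹ * xAl) * Z) - (Z⁻¹ * (xAm_Ah - (Z⁻¹ * xAh) * xAm - (Z⁻¹ * xAm) * xAh + (Z⁻¹ * xAm) * (Z⁻¹ *
            xAh) * Z)) * (Z⁻¹ * (xAk_Al - (Z⁻¹ * xAl) * xAk - (Z⁻¹ * xAk) * xAl + (Z⁻¹ * xAk) * (Z⁻¹ * xAl) * Z)) - (Z⁻¹ * (xAm_Ak - (Z⁻¹ * xAk) *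
            xAm - (Z⁻¹ * xAm) * xAk + (Z⁻¹ * xAm) * (Z⁻¹ * xAk) * Z)) * (Z⁻¹ * (xAh_Al - (Z⁻¹ * xAl) * xAh - (Z⁻¹ * xAh) * xAl + (Z⁻¹ * xAh) * (Z⁻¹ *
            xAl) * Z)) - (Z⁻¹ * (xAm_Al - (Z⁻¹ * xAl) * xAm - (Z⁻¹ * xAm) * xAl + (Z⁻¹ * xAm) * (Z⁻¹ * xAl) * Z)) * (Z⁻¹ * (xAh_Ak - (Z⁻¹ * xAk) *
            xAh - (Z⁻¹ * xAh) * xAk + (Z⁻¹ * xAh) * (Z⁻¹ * xAk) * Z))) := by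
  field_simp
  ring

/-! ## §2. Toy -/

/-- Toy (the centred pair in letters): `Z⁻¹(x_AB − (Z⁻¹x_A)x_B − (Z⁻¹x_B)x_A + (Z⁻¹x_A)(Z⁻¹x_B)Z) = Z⁻¹x_AB − Z⁻²x_Ax_B`. -/
example (Z p q r : ℝ) (hZ : Z ≠ 0) : Z⁻¹ * (r - Z⁻¹ * p * q - Z⁻¹ * q * p + Z⁻¹ * p * (Z⁻¹ * q) * Z) = Z⁻¹ * r - (Z ^ 2)⁻¹ * (p * q) := by
  field_simp
  ring

end Summit.QuantumFields.BalabanUV.T4Continuum.NE7b.SupFourthCumulantIdentityCentred
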